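import Mathlib.Analysis.InnerProductSpace.Basic
import Mathlib.Analysis.Normed.Operator.Mul
import Literature.Analysis.FluidPDE.EulerReynolds
import HarnessLib

/-!
# Uniform limits of space–time fields on `[0,T] × T^d`: algebra and passage to the limit in
double integrals

Support file (theorem-only) for the convex-integration limit steps on the flat torus: the
sequences `(v_q, p_q, R_q, …)` produced by an iteration converge **uniformly** on `[0,T] × T^d`
and one passes to the limit in tested (weak) identities whose integrands are polynomial in the
fields (Buckmaster–De Lellis–Székelyhidi–Vicol 2019, §2.2; De Lellis–Kwon 2022, §2.2: "Since
`(R_q, κ_q, φ_q)` converges to `0` in `C⁰([0,T] × T³)`, the limit `(v,p)` solves the Euler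
equation and satisfies the local energy equality in the distributional sense"). The tree's
`Torus.isWeakEulerSolutionOn_of_unifLimit` (`EulerReynolds`) does this by hand for the
pressure-free momentum equation; here the bookkeeping is packaged once:

* uniform approximation on a time set `S`, in the explicit form used throughout the tree,
  `∀ ε > 0, ∃ N, ∀ q ≥ N, ∀ t ∈ S, ∀ x, ‖w q t x - u t x‖ ≤ ε`, is closed under sums, finite
  sums, continuous bilinear maps of **bounded** limits (`unifTo_bilin`; inner products, products,
  scalar multiplication), coordinates and squared norms;
* `tendsto_integral_integral_of_unifTo`: if `g_q → g` uniformly on `[0,T] × T^d` and all lifts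
  are continuous, then `∫₀ᵀ∫ g_q → ∫₀ᵀ∫ g` (from `Torus.norm_integral_sub_integral_le`);
* `lintegral_lintegral_lt_top_of_le` : iterated `lintegral`s of a bounded `ℝ≥0∞`-valued field
  over `(0,T) × T^d` are finite (the integrability conjuncts of the weak notions for continuous
  limits).

## References

* T. Buckmaster, C. De Lellis, L. Székelyhidi Jr., V. Vicol, CPAM 72 (2019), §2.2.
  [BuckmasterEtAl2018]
* C. De Lellis, H. Kwon, Anal. PDE 15 (2022) = arXiv:2006.06482, §2.2. [DelellisKwon2022]
-/

noncomputable section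

open MeasureTheory Set Filter Function
open scoped InnerProductSpace RealInnerProductSpace ENNReal NNReal Topology

namespace Literature.Analysis.FluidPDE.Torus

variable {d : Type*} [Fintype d]
variable {E F G : Type*} [NormedAddCommGroup E] [NormedSpace ℝ E] [NormedAddCommGroup F]
  [NormedSpace ℝ F] [NormedAddCommGroup G] [NormedSpace ℝ G]
variable {S : Set ℝ}

/-! ### Algebra of uniform approximation -/

omit [Fintype d] [NormedSpace ℝ F] in
/-- A constant sequence approximates its value uniformly. [folklore] -/
theorem unifTo_const (u : ℝ → UnitAddTorus d → F) :
    ∀ ε > (0 : ℝ), ∃ N : ℕ, ∀ q ≥ N, ∀ t ∈ S, ∀ x, ‖u t x - u t x‖ ≤ ε :=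
  fun ε hε => ⟨0, fun _ _ _ _ _ => by simpa using hε.le⟩

omit [Fintype d] [NormedSpace ℝ F] in
/-- Uniform approximation restricts to smaller time sets. [folklore] -/
theorem unifTo_mono {S' : Set ℝ} {w : ℕ → ℝ → UnitAddTorus d → F} {u : ℝ → UnitAddTorus d → F}
    (hw : ∀ ε > (0 : ℝ), ∃ N : ℕ, ∀ q ≥ N, ∀ t ∈ S, ∀ x, ‖w q t x - u t x‖ ≤ ε) (hS : S' ⊆ S) :
    ∀ ε > (0 : ℝ), ∃ N : ℕ, ∀ q ≥ N, ∀ t ∈ S', ∀ x, ‖w q t x - u t x‖ ≤ ε := fun ε hε => by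
  obtain ⟨N, hN⟩ := hw ε hε
  exact ⟨N, fun q hq t ht x => hN q hq t (hS ht) x⟩

omit [Fintype d] [NormedSpace ℝ F] in
/-- Uniform approximation is invariant under pointwise rewriting of the sequence and of the
limit on `S × T^d`. [folklore] -/
theorem unifTo_congr {w w' : ℕ → ℝ → UnitAddTorus d → F} {u u' : ℝ → UnitAddTorus d → F}
    (hw : ∀ ε > (0 : ℝ), ∃ N : ℕ, ∀ q ≥ N, ∀ t ∈ S, ∀ x, ‖w q t x - u t x‖ ≤ ε)
    (heq : ∀ q, ∀ t ∈ S, ∀ x, w q t x = w' q t x) (heq₀ : ∀ t ∈ S, ∀ x, u t x = u' t x) :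
    ∀ ε > (0 : ℝ), ∃ N : ℕ, ∀ q ≥ N, ∀ t ∈ S, ∀ x, ‖w' q t x - u' t x‖ ≤ ε := fun ε hε => by
  obtain ⟨N, hN⟩ := hw ε hε
  exact ⟨N, fun q hq t ht x => by rw [← heq q t ht x, ← heq₀ t ht x]; exact hN q hq t ht x⟩

omit [Fintype d] [NormedSpace ℝ F] in
/-- A uniformly vanishing sequence approximates the zero field uniformly. [folklore] -/
theorem unifTo_zero_of_norm_le {w : ℕ → ℝ → UnitAddTorus d → F}
    (hw : ∀ ε > (0 : ℝ), ∃ N : ℕ, ∀ q ≥ N, ∀ t ∈ S, ∀ x, ‖w q t x‖ ≤ ε) :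
    ∀ ε > (0 : ℝ), ∃ N : ℕ, ∀ q ≥ N, ∀ t ∈ S, ∀ x,
      ‖w q t x - (0 : ℝ → UnitAddTorus d → F) t x‖ ≤ ε := by
  simpa only [Pi.zero_apply, sub_zero] using hw

omit [Fintype d] [NormedSpace ℝ F] in
/-- Uniform approximation is preserved by sums. [folklore] -/
theorem unifTo_add {w w' : ℕ → ℝ → UnitAddTorus d → F} {u u' : ℝ → UnitAddTorus d → F}
    (hw : ∀ ε > (0 : ℝ), ∃ N : ℕ, ∀ q ≥ N, ∀ t ∈ S, ∀ x, ‖w q t x - u t x‖ ≤ ε)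
    (hw' : ∀ ε > (0 : ℝ), ∃ N : ℕ, ∀ q ≥ N, ∀ t ∈ S, ∀ x, ‖w' q t x - u' t x‖ ≤ ε) :
    ∀ ε > (0 : ℝ), ∃ N : ℕ, ∀ q ≥ N, ∀ t ∈ S, ∀ x,
      ‖(w q t x + w' q t x) - (u t x + u' t x)‖ ≤ ε := fun ε hε => by
  obtain ⟨N, hN⟩ := hw (ε / 2) (half_pos hε)
  obtain ⟨N', hN'⟩ := hw' (ε / 2) (half_pos hε)
  refine ⟨max N N', fun q hq t ht x => ?_⟩
  calc ‖(w q t x + w' q t x) - (u t x + u' t x)‖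
      = ‖(w q t x - u t x) + (w' q t x - u' t x)‖ := by abel_nf
    _ ≤ ‖w q t x - u t x‖ + ‖w' q t x - u' t x‖ := norm_add_le _ _
    _ ≤ ε / 2 + ε / 2 :=
        add_le_add (hN q ((le_max_left _ _).trans hq) t ht x)
          (hN' q ((le_max_right _ _).trans hq) t ht x)
    _ = ε := add_halves ε

omit [Fintype d] [NormedSpace ℝ F] in
/-- Uniform approximation is preserved by differences. [folklore] -/
theorem unifTo_sub {w w' : ℕ → ℝ → UnitAddTorus d → F} {u u' : ℝ → UnitAddTorus d → F}
    (hw : ∀ ε > (0 : ℝ), ∃ N : ℕ, ∀ q ≥ N, ∀ t ∈ S, ∀ x, ‖w q t x - u t x‖ ≤ ε)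
    (hw' : ∀ ε > (0 : ℝ), ∃ N : ℕ, ∀ q ≥ N, ∀ t ∈ S, ∀ x, ‖w' q t x - u' t x‖ ≤ ε) :
    ∀ ε > (0 : ℝ), ∃ N : ℕ, ∀ q ≥ N, ∀ t ∈ S, ∀ x,
      ‖(w q t x - w' q t x) - (u t x - u' t x)‖ ≤ ε := fun ε hε => by
  obtain ⟨N, hN⟩ := hw (ε / 2) (half_pos hε)
  obtain ⟨N', hN'⟩ := hw' (ε / 2) (half_pos hε)
  refine ⟨max N N', fun q hq t ht x => ?_⟩
  calc ‖(w q t x - w' q t x) - (u t x - u' t x)‖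
      = ‖(w q t x - u t x) - (w' q t x - u' t x)‖ := by abel_nf
    _ ≤ ‖w q t x - u t x‖ + ‖w' q t x - u' t x‖ := norm_sub_le _ _
    _ ≤ ε / 2 + ε / 2 :=
        add_le_add (hN q ((le_max_left _ _).trans hq) t ht x)
          (hN' q ((le_max_right _ _).trans hq) t ht x)
    _ = ε := add_halves ε

omit [Fintype d] [NormedSpace ℝ F] in
/-- Uniform approximation is preserved by finite sums. [folklore] -/
theorem unifTo_sum {ι : Type*} (s : Finset ι) {w : ι → ℕ → ℝ → UnitAddTorus d → F}
    {u : ι → ℝ → UnitAddTorus d → F}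
    (hw : ∀ i ∈ s, ∀ ε > (0 : ℝ), ∃ N : ℕ, ∀ q ≥ N, ∀ t ∈ S, ∀ x, ‖w i q t x - u i t x‖ ≤ ε) :
    ∀ ε > (0 : ℝ), ∃ N : ℕ, ∀ q ≥ N, ∀ t ∈ S, ∀ x,
      ‖(∑ i ∈ s, w i q t x) - ∑ i ∈ s, u i t x‖ ≤ ε := by
  classical
  induction s using Finset.induction_on with
  | empty => intro ε hε; exact ⟨0, fun _ _ _ _ _ => by simpa using hε.le⟩
  | insert a s ha ih =>
    intro ε hε
    have h1 := hw a (Finset.mem_insert_self a s)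
    have h2 := ih fun i hi => hw i (Finset.mem_insert_of_mem hi)
    obtain ⟨N, hN⟩ := unifTo_add h1 h2 ε hε
    refine ⟨N, fun q hq t ht x => ?_⟩
    rw [Finset.sum_insert ha, Finset.sum_insert ha]
    exact hN q hq t ht x

omit [Fintype d] [NormedSpace ℝ F] in
/-- A sequence approximating a bounded limit uniformly is eventually uniformly bounded. [folklore] -/
theorem exists_bound_of_unifTo {w : ℕ → ℝ → UnitAddTorus d → F} {u : ℝ → UnitAddTorus d → F}
    (hw : ∀ ε > (0 : ℝ), ∃ N : ℕ, ∀ q ≥ N, ∀ t ∈ S, ∀ x, ‖w q t x - u t x‖ ≤ ε) {C : ℝ}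
    (hu : ∀ t ∈ S, ∀ x, ‖u t x‖ ≤ C) :
    ∃ N : ℕ, ∀ q ≥ N, ∀ t ∈ S, ∀ x, ‖w q t x‖ ≤ C + 1 := by
  obtain ⟨N, hN⟩ := hw 1 one_pos
  refine ⟨N, fun q hq t ht x => ?_⟩
  calc ‖w q t x‖ = ‖(w q t x - u t x) + u t x‖ := by rw [sub_add_cancel]
    _ ≤ ‖w q t x - u t x‖ + ‖u t x‖ := norm_add_le _ _
    _ ≤ 1 + C := add_le_add (hN q hq t ht x) (hu t ht x)
    _ = C + 1 := add_comm _ _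

omit [Fintype d] in
/-- **Continuous bilinear maps of uniformly approximated bounded fields are uniformly
approximated**: if `w_q → u` and `w'_q → u'` uniformly on `S × T^d` with `u, u'` bounded there,
then `B(w_q, w'_q) → B(u, u')` uniformly, for every continuous bilinear `B`
(`‖B a b - B a₀ b₀‖ ≤ ‖B‖ (‖a - a₀‖ ‖b‖ + ‖a₀‖ ‖b - b₀‖)`). [folklore] -/
theorem unifTo_bilin (B : E →L[ℝ] F →L[ℝ] G) {w : ℕ → ℝ → UnitAddTorus d → E}
    {u : ℝ → UnitAddTorus d → E} {w' : ℕ → ℝ → UnitAddTorus d → F}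
    {u' : ℝ → UnitAddTorus d → F}
    (hw : ∀ ε > (0 : ℝ), ∃ N : ℕ, ∀ q ≥ N, ∀ t ∈ S, ∀ x, ‖w q t x - u t x‖ ≤ ε)
    (hw' : ∀ ε > (0 : ℝ), ∃ N : ℕ, ∀ q ≥ N, ∀ t ∈ S, ∀ x, ‖w' q t x - u' t x‖ ≤ ε)
    {C C' : ℝ} (hu : ∀ t ∈ S, ∀ x, ‖u t x‖ ≤ C) (hu' : ∀ t ∈ S, ∀ x, ‖u' t x‖ ≤ C') :
    ∀ ε > (0 : ℝ), ∃ N : ℕ, ∀ q ≥ N, ∀ t ∈ S, ∀ x,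
      ‖B (w q t x) (w' q t x) - B (u t x) (u' t x)‖ ≤ ε := by
  intro ε hε
  set L : ℝ := (‖B‖ + 1) * (|C| + |C'| + 2) with hL
  have hL0 : 0 < L := by positivity
  set δ : ℝ := ε / L with hδ
  have hδ0 : 0 < δ := div_pos hε hL0
  obtain ⟨N, hN⟩ := hw δ hδ0
  obtain ⟨N', hN'⟩ := hw' (min 1 δ) (lt_min one_pos hδ0)
  refine ⟨max N N', fun q hq t ht x => ?_⟩
  have h1 : ‖w q t x - u t x‖ ≤ δ := hN q ((le_max_left _ _).trans hq) t ht x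
  have h2 : ‖w' q t x - u' t x‖ ≤ min 1 δ := hN' q ((le_max_right _ _).trans hq) t ht x
  have hb : ‖w' q t x‖ ≤ |C'| + 1 := by
    calc ‖w' q t x‖ = ‖(w' q t x - u' t x) + u' t x‖ := by rw [sub_add_cancel]
      _ ≤ ‖w' q t x - u' t x‖ + ‖u' t x‖ := norm_add_le _ _
      _ ≤ 1 + |C'| := add_le_add (h2.trans (min_le_left _ _)) ((hu' t ht x).trans (le_abs_self _))
      _ = |C'| + 1 := add_comm _ _
  have ha : ‖u t x‖ ≤ |C| := (hu t ht x).trans (le_abs_self _)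
  have e : B (w q t x) (w' q t x) - B (u t x) (u' t x) =
      B (w q t x - u t x) (w' q t x) + B (u t x) (w' q t x - u' t x) := by
    simp only [map_sub, FunLike.coe_sub, Pi.sub_apply]; abel
  rw [e]
  calc ‖B (w q t x - u t x) (w' q t x) + B (u t x) (w' q t x - u' t x)‖
      ≤ ‖B (w q t x - u t x) (w' q t x)‖ + ‖B (u t x) (w' q t x - u' t x)‖ := norm_add_le _ _
    _ ≤ ‖B‖ * ‖w q t x - u t x‖ * ‖w' q t x‖ + ‖B‖ * ‖u t x‖ * ‖w' q t x - u' t x‖ :=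
        add_le_add (B.le_opNorm₂ _ _) (B.le_opNorm₂ _ _)
    _ ≤ ‖B‖ * δ * (|C'| + 1) + ‖B‖ * |C| * δ := by
        gcongr
        · exact h2.trans (min_le_right _ _)
    _ ≤ L * δ := by
        rw [hL]
        have hB := norm_nonneg B
        nlinarith [abs_nonneg C, abs_nonneg C', hδ0.le]
    _ = ε := by rw [hδ]; field_simp

omit [Fintype d] in
/-- Inner products of uniformly approximated bounded fields are uniformly approximated. [folklore] -/
theorem unifTo_inner {H : Type*} [NormedAddCommGroup H] [InnerProductSpace ℝ H]
    {w w' : ℕ → ℝ → UnitAddTorus d → H} {u u' : ℝ → UnitAddTorus d → H}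
    (hw : ∀ ε > (0 : ℝ), ∃ N : ℕ, ∀ q ≥ N, ∀ t ∈ S, ∀ x, ‖w q t x - u t x‖ ≤ ε)
    (hw' : ∀ ε > (0 : ℝ), ∃ N : ℕ, ∀ q ≥ N, ∀ t ∈ S, ∀ x, ‖w' q t x - u' t x‖ ≤ ε)
    {C C' : ℝ} (hu : ∀ t ∈ S, ∀ x, ‖u t x‖ ≤ C) (hu' : ∀ t ∈ S, ∀ x, ‖u' t x‖ ≤ C') :
    ∀ ε > (0 : ℝ), ∃ N : ℕ, ∀ q ≥ N, ∀ t ∈ S, ∀ x,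
      ‖⟪w q t x, w' q t x⟫_ℝ - ⟪u t x, u' t x⟫_ℝ‖ ≤ ε := by
  exact unifTo_bilin (innerSL ℝ) hw hw' hu hu'

omit [Fintype d] in
/-- Products of uniformly approximated bounded real fields are uniformly approximated. [folklore] -/
theorem unifTo_mul {w w' : ℕ → ℝ → UnitAddTorus d → ℝ} {u u' : ℝ → UnitAddTorus d → ℝ}
    (hw : ∀ ε > (0 : ℝ), ∃ N : ℕ, ∀ q ≥ N, ∀ t ∈ S, ∀ x, ‖w q t x - u t x‖ ≤ ε)
    (hw' : ∀ ε > (0 : ℝ), ∃ N : ℕ, ∀ q ≥ N, ∀ t ∈ S, ∀ x, ‖w' q t x - u' t x‖ ≤ ε)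
    {C C' : ℝ} (hu : ∀ t ∈ S, ∀ x, ‖u t x‖ ≤ C) (hu' : ∀ t ∈ S, ∀ x, ‖u' t x‖ ≤ C') :
    ∀ ε > (0 : ℝ), ∃ N : ℕ, ∀ q ≥ N, ∀ t ∈ S, ∀ x,
      ‖w q t x * w' q t x - u t x * u' t x‖ ≤ ε := by
  simpa only [ContinuousLinearMap.mul_apply'] using
    unifTo_bilin (ContinuousLinearMap.mul ℝ ℝ) hw hw' hu hu'

omit [Fintype d] in
/-- Scalar multiples of uniformly approximated bounded fields are uniformly approximated. [folklore] -/
theorem unifTo_smul {w : ℕ → ℝ → UnitAddTorus d → ℝ} {u : ℝ → UnitAddTorus d → ℝ}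
    {w' : ℕ → ℝ → UnitAddTorus d → F} {u' : ℝ → UnitAddTorus d → F}
    (hw : ∀ ε > (0 : ℝ), ∃ N : ℕ, ∀ q ≥ N, ∀ t ∈ S, ∀ x, ‖w q t x - u t x‖ ≤ ε)
    (hw' : ∀ ε > (0 : ℝ), ∃ N : ℕ, ∀ q ≥ N, ∀ t ∈ S, ∀ x, ‖w' q t x - u' t x‖ ≤ ε)
    {C C' : ℝ} (hu : ∀ t ∈ S, ∀ x, ‖u t x‖ ≤ C) (hu' : ∀ t ∈ S, ∀ x, ‖u' t x‖ ≤ C') :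
    ∀ ε > (0 : ℝ), ∃ N : ℕ, ∀ q ≥ N, ∀ t ∈ S, ∀ x,
      ‖w q t x • w' q t x - u t x • u' t x‖ ≤ ε := by
  simpa only [ContinuousLinearMap.lsmul_apply] using
    unifTo_bilin (ContinuousLinearMap.lsmul ℝ ℝ) hw hw' hu hu'

omit [Fintype d] in
/-- Squared norms of uniformly approximated bounded fields are uniformly approximated. [folklore] -/
theorem unifTo_norm_sq {H : Type*} [NormedAddCommGroup H] [InnerProductSpace ℝ H]
    {w : ℕ → ℝ → UnitAddTorus d → H} {u : ℝ → UnitAddTorus d → H}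
    (hw : ∀ ε > (0 : ℝ), ∃ N : ℕ, ∀ q ≥ N, ∀ t ∈ S, ∀ x, ‖w q t x - u t x‖ ≤ ε)
    {C : ℝ} (hu : ∀ t ∈ S, ∀ x, ‖u t x‖ ≤ C) :
    ∀ ε > (0 : ℝ), ∃ N : ℕ, ∀ q ≥ N, ∀ t ∈ S, ∀ x,
      ‖‖w q t x‖ ^ 2 - ‖u t x‖ ^ 2‖ ≤ ε := by
  simpa only [real_inner_self_eq_norm_sq] using unifTo_inner hw hw hu hu

/-- Coordinates of uniformly approximated vector fields are uniformly approximated. [folklore] -/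
theorem unifTo_apply {w : ℕ → ℝ → UnitAddTorus d → EuclideanSpace ℝ d}
    {u : ℝ → UnitAddTorus d → EuclideanSpace ℝ d}
    (hw : ∀ ε > (0 : ℝ), ∃ N : ℕ, ∀ q ≥ N, ∀ t ∈ S, ∀ x, ‖w q t x - u t x‖ ≤ ε) (i : d) :
    ∀ ε > (0 : ℝ), ∃ N : ℕ, ∀ q ≥ N, ∀ t ∈ S, ∀ x, ‖w q t x i - u t x i‖ ≤ ε := fun ε hε => by
  obtain ⟨N, hN⟩ := hw ε hε
  refine ⟨N, fun q hq t ht x => ?_⟩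
  calc ‖w q t x i - u t x i‖ = ‖(w q t x - u t x) i‖ := by rw [PiLp.sub_apply]
    _ ≤ ‖w q t x - u t x‖ := PiLp.norm_apply_le _ i
    _ ≤ ε := hN q hq t ht x

omit [Fintype d] in
/-- A uniformly vanishing sequence paired (by a continuous bilinear map) with an eventually
bounded one vanishes uniformly — the shape of the error terms `κ_q ∂ₜψ`, `⟨R_q v_q, ∇ψ⟩`,
`⟨φ_q, ∇ψ⟩` of a convex-integration limit. [folklore] -/
theorem unifTo_bilin_zero (B : E →L[ℝ] F →L[ℝ] G) {w : ℕ → ℝ → UnitAddTorus d → E}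
    {w' : ℕ → ℝ → UnitAddTorus d → F}
    (hw : ∀ ε > (0 : ℝ), ∃ N : ℕ, ∀ q ≥ N, ∀ t ∈ S, ∀ x, ‖w q t x‖ ≤ ε)
    {K : ℝ} {N₀ : ℕ} (hw' : ∀ q ≥ N₀, ∀ t ∈ S, ∀ x, ‖w' q t x‖ ≤ K) :
    ∀ ε > (0 : ℝ), ∃ N : ℕ, ∀ q ≥ N, ∀ t ∈ S, ∀ x, ‖B (w q t x) (w' q t x)‖ ≤ ε := by
  intro ε hε
  have hL : 0 < (‖B‖ + 1) * (|K| + 1) := by positivity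
  obtain ⟨N, hN⟩ := hw (ε / ((‖B‖ + 1) * (|K| + 1))) (div_pos hε hL)
  refine ⟨max N N₀, fun q hq t ht x => ?_⟩
  have h1 := hN q ((le_max_left _ _).trans hq) t ht x
  have h2 : ‖w' q t x‖ ≤ |K| := (hw' q ((le_max_right _ _).trans hq) t ht x).trans (le_abs_self _)
  calc ‖B (w q t x) (w' q t x)‖ ≤ ‖B‖ * ‖w q t x‖ * ‖w' q t x‖ := B.le_opNorm₂ _ _
    _ ≤ ‖B‖ * (ε / ((‖B‖ + 1) * (|K| + 1))) * |K| := by gcongr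
    _ ≤ (‖B‖ + 1) * (ε / ((‖B‖ + 1) * (|K| + 1))) * (|K| + 1) := by
        gcongr
        · linarith
        · linarith
    _ = ε := by field_simp

/-! ### Passage to the limit in double integrals over `(0,T) × T^d` -/

/-- **Uniform convergence on `[0,T] × T^d` passes to the iterated integral over `(0,T) × T^d`**
(for real fields with continuous space–time lifts; `Torus.norm_integral_sub_integral_le`).
[cite: BuckmasterEtAl2018, §2.2] -/
theorem tendsto_integral_integral_of_unifTo {T : ℝ} (hT : 0 ≤ T) {g : ℕ → ℝ → UnitAddTorus d → ℝ}
    {g₀ : ℝ → UnitAddTorus d → ℝ}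
    (hg : ∀ q, ContinuousOn (FunctionSpaces.Torus.stLift (g q)) (Icc 0 T ×ˢ univ))
    (hg₀ : ContinuousOn (FunctionSpaces.Torus.stLift g₀) (Icc 0 T ×ˢ univ))
    (h : ∀ ε > (0 : ℝ), ∃ N : ℕ, ∀ q ≥ N, ∀ t ∈ Icc 0 T, ∀ x, ‖g q t x - g₀ t x‖ ≤ ε) :
    Tendsto (fun q => ∫ t in Ioo 0 T, ∫ x, g q t x) atTop
      (𝓝 (∫ t in Ioo 0 T, ∫ x, g₀ t x)) := by
  rw [Metric.tendsto_atTop]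
  intro ε hε
  obtain ⟨N, hN⟩ := h (ε / (2 * (T + 1))) (div_pos hε (by positivity))
  refine ⟨N, fun q hq => ?_⟩
  rw [dist_eq_norm]
  calc ‖(∫ t in Ioo 0 T, ∫ x, g q t x) - ∫ t in Ioo 0 T, ∫ x, g₀ t x‖
      ≤ T * (ε / (2 * (T + 1))) :=
        norm_integral_sub_integral_le hT (hg q) hg₀ fun t ht x => hN q hq t (Ioo_subset_Icc_self ht) x
    _ < ε := by
        rw [mul_div_assoc', div_lt_iff₀ (by positivity)]
        nlinarith

/-- **Identities pass to uniform limits**: if `∫₀ᵀ∫ g_q = ∫₀ᵀ∫ h_q` for all `q` and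
`g_q → g₀`, `h_q → h₀` uniformly on `[0,T] × T^d` (all lifts continuous), then
`∫₀ᵀ∫ g₀ = ∫₀ᵀ∫ h₀`. [cite: DelellisKwon2022, §2.2] -/
theorem integral_integral_eq_of_unifTo {T : ℝ} (hT : 0 ≤ T) {g h : ℕ → ℝ → UnitAddTorus d → ℝ}
    {g₀ h₀ : ℝ → UnitAddTorus d → ℝ}
    (hg : ∀ q, ContinuousOn (FunctionSpaces.Torus.stLift (g q)) (Icc 0 T ×ˢ univ))
    (hg₀ : ContinuousOn (FunctionSpaces.Torus.stLift g₀) (Icc 0 T ×ˢ univ))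
    (hh : ∀ q, ContinuousOn (FunctionSpaces.Torus.stLift (h q)) (Icc 0 T ×ˢ univ))
    (hh₀ : ContinuousOn (FunctionSpaces.Torus.stLift h₀) (Icc 0 T ×ˢ univ))
    (hgl : ∀ ε > (0 : ℝ), ∃ N : ℕ, ∀ q ≥ N, ∀ t ∈ Icc 0 T, ∀ x, ‖g q t x - g₀ t x‖ ≤ ε)
    (hhl : ∀ ε > (0 : ℝ), ∃ N : ℕ, ∀ q ≥ N, ∀ t ∈ Icc 0 T, ∀ x, ‖h q t x - h₀ t x‖ ≤ ε)
    (heq : ∀ q, ∫ t in Ioo 0 T, ∫ x, g q t x = ∫ t in Ioo 0 T, ∫ x, h q t x) :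
    ∫ t in Ioo 0 T, ∫ x, g₀ t x = ∫ t in Ioo 0 T, ∫ x, h₀ t x :=
  tendsto_nhds_unique (tendsto_integral_integral_of_unifTo hT hg hg₀ hgl)
    ((tendsto_integral_integral_of_unifTo hT hh hh₀ hhl).congr fun q => (heq q).symm)

/-! ### Integrability conjuncts for bounded fields -/

/-- Iterated `lintegral`s over `(0,T) × T^d` of an `ℝ≥0∞`-valued field bounded by a finite
constant are finite (the torus has volume one). [folklore] -/
theorem lintegral_lintegral_lt_top_of_le
    {T : ℝ} {Φ : ℝ → UnitAddTorus d → ℝ≥0∞} {B : ℝ≥0∞} (hB : B ≠ ∞)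
    (h : ∀ t ∈ Ioo 0 T, ∀ x, Φ t x ≤ B) :
    ∫⁻ t in Ioo 0 T, ∫⁻ x, Φ t x < ∞ := by
  calc ∫⁻ t in Ioo 0 T, ∫⁻ x, Φ t x
      ≤ ∫⁻ _ in Ioo 0 T, B :=
        setLIntegral_mono' measurableSet_Ioo fun t ht =>
          calc ∫⁻ x, Φ t x ≤ ∫⁻ _, B := lintegral_mono (h t ht)
            _ = B := by rw [lintegral_const, measure_univ, mul_one]
    _ = B * volume (Ioo 0 T) := setLIntegral_const _ _
    _ < ∞ := ENNReal.mul_lt_top hB.lt_top (by rw [Real.volume_Ioo]; exact ENNReal.ofReal_lt_top)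

/-! ### Continuity of space–time lifts of composite fields -/

omit [Fintype d] [NormedSpace ℝ F] in
/-- Finite sums of fields with continuous space–time lifts have continuous lifts. [folklore] -/
theorem continuousOn_stLift_sum {ι : Type*} (s : Finset ι) {f : ι → ℝ → UnitAddTorus d → F}
    {A : Set (ℝ × EuclideanSpace ℝ d)}
    (hf : ∀ i ∈ s, ContinuousOn (FunctionSpaces.Torus.stLift (f i)) A) :
    ContinuousOn (FunctionSpaces.Torus.stLift fun t x => ∑ i ∈ s, f i t x) A := by
  have e : (FunctionSpaces.Torus.stLift fun t x => ∑ i ∈ s, f i t x) =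
      fun z => ∑ i ∈ s, FunctionSpaces.Torus.stLift (f i) z := by
    funext z; simp [FunctionSpaces.Torus.stLift]
  rw [e]
  exact continuousOn_finsetSum s hf

omit [Fintype d] [NormedSpace ℝ F] in
/-- A function of time alone, continuous on `S`, has a space–time lift continuous on `S × ℝ^d`. [folklore] -/
theorem continuousOn_stLift_of_time {D : ℝ → F} (hD : ContinuousOn D S) :
    ContinuousOn (FunctionSpaces.Torus.stLift fun (t : ℝ) (_ : UnitAddTorus d) => D t) (S ×ˢ univ) :=
  hD.comp continuousOn_fst fun _ hz => (mem_prod.1 hz).1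

end Literature.Analysis.FluidPDE.Torus
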